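import Summits.CriticalPhenomena.CardyFormulaZ2.Theses.CardySelfRefinement
import Literature.Probability.RandomPlanarGeometry.ChordalCurveFamilyProofs
import Mathlib.MeasureTheory.Constructions.Polish.Basic
import Mathlib.Probability.Kernel.Disintegration.StandardBorel
import HarnessLib

/-!
# Stopping at a closed set is Borel: partial helpers for stub `stub_markovPassage` of line
`crosscut-dictionary` for crux `LagHandOff` (stmt-CriticalPhenomena-10268)

The registered stub asks that the decoded family `P D := (Ψ D)_* μ` of a cross-cut dictionary
`Ψ` be domain Markov in the tree's SET-based sense (`ChordalFamily.IsDomainMarkov`: one kernel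
`Q D past` with `initial`, `markov` at EVERY closed `F`, `domain`).  This file lands the
measure-theoretic half of the bookkeeping (companion file `…LagHandOffMarkovKernel.lean` has the
kernel half):

* `measurable_stopAt`, `measurable_startFrom` — for closed `F`, stopping an UNparametrised
  curve at / restarting it from its first hitting of `F` (`CurveClass.stopAt F`,
  `CurveClass.startFrom F`) is a Borel map of `CurveClass E` (`E` complete separable metric,
  e.g. `ℂ`).  Proof: the hitting parameter is lower semicontinuous on PARAMETRISED curves for
  the sup metric (`isClosed_setOf_hitParam_le`: projection along the compact parameter
  interval), so `g ↦ [g ∘ affineClamp 0 σ_F(g)]` is Borel on the Polish space `C([0,1], E)`;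
  it is constant on the fibres of `g ↦ [g]` (representative independence,
  `CurveClass.stopAt_mk_holds`, in tree), and a fibre-constant Borel map descends to a Borel
  map of the quotient by Souslin's separation theorem (`measurable_of_measurable_comp_mk`,
  Mathlib's `AnalyticSet.measurableSet_of_compl`).  Hence the events `stopAt F ⁻¹' S` in
  `IsLocal`, `IsTargetIndependent` and in the `markov` clause are genuine Borel events.
* `exists_kernel_stopAt_startFrom` — the `markov` clause at ONE closed `F` is a tautology:
  `Measure.condKernel` of the joint law of `(stopAt F, startFrom F)` on the standard Borel
  space `CurveClass E` does it, for ANY finite law.  So the content of `markov` is that ONE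
  kernel serves ALL closed `F` (stopping-set consistency) — which is not vacuous (two atoms
  `[0,1]`, `[0,2] ⊆ ℂ` tested at `F = ∅` and `F = {1}` already obstruct it).
* `stopAt_empty`, `startFrom_empty` — at `F = ∅` the past is the whole curve and the future is
  the constant curve at the target.

References: W. Werner, Lectures on two-dimensional critical percolation (2007) §3.2 (domain
Markov property); M. Aizenman, A. Burchard, Duke Math. J. 99 (1999) §2.1 (curve space);
Souslin–Lusin separation (Kechris, Classical Descriptive Set Theory, Thm 14.7) as in Mathlib.
-/

noncomputable section

open MeasureTheory ProbabilityTheory Filter Set Topology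
open scoped BoundedContinuousFunction unitInterval
open Literature.Probability.Percolation Literature.Probability.LatticeModels
open Literature.Probability.RandomPlanarGeometry Literature.Probability.Percolation.QuadCrossing
open Summit.CriticalPhenomena.CardyFormulaZ2.Theses.CardySelfRefinement

namespace Summit.CriticalPhenomena.CardyFormulaZ2.Cruxes.LagHandOff.CrosscutDictionary

section HitParam

variable {E : Type*} [MetricSpace E]

/-- **Lower semicontinuity of the first hitting parameter** on PARAMETRISED curves (sup metric):
for closed `F` and `a < 1` the set of `g : C([0,1], E)` whose hitting parameter of `F` is `≤ a`
is closed — it is the projection along the compact factor `[0,1]` of the closed set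
`{(t, g) | t ≤ a, g t ∈ F}`. [folklore] -/
theorem isClosed_setOf_hitParam_le {F : Set E} (hF : IsClosed F) {a : ℝ} (ha : a < 1) :
    IsClosed {g : C(I, E) | (Curve.mk g).hitParam F ≤ a} := by
  have hK : IsClosed {p : I × C(I, E) | (p.1 : ℝ) ≤ a ∧ p.2 p.1 ∈ F} :=
    (isClosed_le (continuous_subtype_val.comp continuous_fst) continuous_const).inter
      (hF.preimage (continuous_snd.eval continuous_fst))
  have heq : {g : C(I, E) | (Curve.mk g).hitParam F ≤ a} =
      Prod.snd '' {p : I × C(I, E) | (p.1 : ℝ) ≤ a ∧ p.2 p.1 ∈ F} := by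
    ext g
    simp only [mem_setOf_eq, mem_image, Prod.exists, exists_eq_right]
    constructor
    · intro hg
      rcases Curve.hitParam_mem_hitSet hF (Curve.mk g) with ⟨hI, hmem⟩ | h1
      · exact ⟨⟨_, hI⟩, hg, hmem⟩
      · exact absurd (mem_singleton_iff.1 h1 ▸ hg) (not_le.2 ha)
    · rintro ⟨t, ht, hmem⟩
      exact (Curve.hitParam_le (γ := Curve.mk g) hmem).trans ht
  rw [heq]
  exact isClosedMap_snd_of_compactSpace _ hK

/-- The first hitting parameter of a closed set is a Borel function of the parametrised curve
(Borel σ-algebra of the sup metric on `C([0,1], E)`). [folklore] -/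
theorem measurable_hitParam {F : Set E} (hF : IsClosed F) :
    Measurable[borel C(I, E)] fun g : C(I, E) => (Curve.mk g).hitParam F := by
  letI : MeasurableSpace C(I, E) := borel _
  haveI : BorelSpace C(I, E) := ⟨rfl⟩
  refine measurable_of_Iic fun a => ?_
  by_cases ha : a < 1
  · exact (isClosed_setOf_hitParam_le hF ha).measurableSet
  · have : (fun g : C(I, E) => (Curve.mk g).hitParam F) ⁻¹' Iic a = univ :=
      eq_univ_of_forall fun g => ((Curve.mk g).hitParam_mem_Icc F).2.trans (not_lt.1 ha)
    rw [this]
    exact MeasurableSet.univ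

/-- The clamped affine reparametrisations `affineClamp a b` depend continuously on `(a, b)` in
the compact-open (= sup) topology. [folklore] -/
theorem continuous_affineClamp :
    Continuous fun p : ℝ × ℝ => Curve.affineClamp p.1 p.2 := by
  let A : C((ℝ × ℝ) × I, I) :=
    ⟨fun q => projIcc 0 1 zero_le_one (q.1.1 + q.1.2 * q.2), continuous_projIcc.comp (by fun_prop)⟩
  have h : (fun p : ℝ × ℝ => Curve.affineClamp p.1 p.2) = A.curry := by
    funext p
    ext s
    rfl
  rw [h]
  exact A.curry.continuous

/-- Stopping a parametrised curve at a prescribed parameter `T` (`g ↦ g ∘ affineClamp 0 T`) is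
jointly continuous in `(g, T)`. [folklore] -/
theorem continuous_comp_affineClamp_stop :
    Continuous fun p : C(I, E) × ℝ => p.1.comp (Curve.affineClamp 0 p.2) := by
  have h1 : Continuous fun p : C(I, E) × ℝ => Curve.affineClamp 0 p.2 :=
    continuous_affineClamp.comp (continuous_const.prodMk continuous_snd)
  exact ContinuousMap.continuous_comp'.comp (h1.prodMk continuous_fst)

/-- Restarting a parametrised curve from a prescribed parameter `T`
(`g ↦ g ∘ affineClamp T (1 - T)`) is jointly continuous in `(g, T)`. [folklore] -/
theorem continuous_comp_affineClamp_start :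
    Continuous fun p : C(I, E) × ℝ => p.1.comp (Curve.affineClamp p.2 (1 - p.2)) := by
  have h1 : Continuous fun p : C(I, E) × ℝ => Curve.affineClamp p.2 (1 - p.2) :=
    continuous_affineClamp.comp (continuous_snd.prodMk (continuous_const.sub continuous_snd))
  exact ContinuousMap.continuous_comp'.comp (h1.prodMk continuous_fst)

/-- The initial segment up to the first hitting of a closed set, read on PARAMETRISED curves and
then projected to curve classes, is Borel for the sup metric. [folklore] -/
theorem measurable_mk_stopAt_mk {F : Set E} (hF : IsClosed F) :
    Measurable[borel C(I, E)] fun g : C(I, E) =>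
      CurveClass.mk ((Curve.mk g).stopAt F) := by
  letI : MeasurableSpace C(I, E) := borel _
  haveI : BorelSpace C(I, E) := ⟨rfl⟩
  have hc : Continuous fun p : C(I, E) × ℝ =>
      CurveClass.mk (Curve.mk (p.1.comp (Curve.affineClamp 0 p.2))) :=
    CurveClass.continuous_mk.comp
      (Curve.lipschitzWith_mk.continuous.comp continuous_comp_affineClamp_stop)
  exact hc.measurable.comp (measurable_id.prodMk (measurable_hitParam hF))

/-- The final segment from the first hitting of a closed set, read on PARAMETRISED curves and
then projected to curve classes, is Borel for the sup metric. [folklore] -/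
theorem measurable_mk_startFrom_mk {F : Set E} (hF : IsClosed F) :
    Measurable[borel C(I, E)] fun g : C(I, E) =>
      CurveClass.mk ((Curve.mk g).startFrom F) := by
  letI : MeasurableSpace C(I, E) := borel _
  haveI : BorelSpace C(I, E) := ⟨rfl⟩
  have hc : Continuous fun p : C(I, E) × ℝ =>
      CurveClass.mk (Curve.mk (p.1.comp (Curve.affineClamp p.2 (1 - p.2)))) :=
    CurveClass.continuous_mk.comp
      (Curve.lipschitzWith_mk.continuous.comp continuous_comp_affineClamp_start)
  exact hc.measurable.comp (measurable_id.prodMk (measurable_hitParam hF))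

end HitParam

section Souslin

variable {E : Type*} [MetricSpace E] [CompleteSpace E] [SecondCountableTopology E]

/-- **Souslin transfer through the parametrisation map.** A map `f` out of the space of curve
classes is Borel as soon as `g ↦ f [g]` is Borel on PARAMETRISED curves `g : C([0,1], E)` (sup
metric; `E` complete separable): `π : g ↦ [g]` is a continuous surjection from a Polish space, so
`f ⁻¹' t = π '' ((f ∘ π) ⁻¹' t)` and its complement are analytic, hence Borel by Souslin's
separation theorem (`AnalyticSet.measurableSet_of_compl`). This is how parametrisation-dependent
constructions (hitting parameters) yield Borel maps of UNparametrised curves. [folklore] -/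
theorem measurable_of_measurable_comp_mk {β : Type*} [MeasurableSpace β] {f : CurveClass E → β}
    (hf : Measurable[borel C(I, E)] fun g : C(I, E) => f (CurveClass.mk (Curve.mk g))) :
    Measurable f := by
  letI : MeasurableSpace C(I, E) := borel _
  haveI : BorelSpace C(I, E) := ⟨rfl⟩
  have hπc : Continuous fun g : C(I, E) => CurveClass.mk (Curve.mk g) :=
    CurveClass.continuous_mk.comp Curve.lipschitzWith_mk.continuous
  have hπs : Function.Surjective fun g : C(I, E) => CurveClass.mk (Curve.mk g) :=
    CurveClass.surjective_mk.comp Curve.surjective_mk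
  have himage : ∀ s : Set β,
      (fun g : C(I, E) => CurveClass.mk (Curve.mk g)) ''
        ((fun g : C(I, E) => f (CurveClass.mk (Curve.mk g))) ⁻¹' s) = f ⁻¹' s :=
    fun s => image_preimage_eq (f ⁻¹' s) hπs
  intro t ht
  have h1 : AnalyticSet (f ⁻¹' t) := by
    rw [← himage t]
    exact (hf ht).analyticSet_image hπc.measurable
  have h2 : AnalyticSet (f ⁻¹' t)ᶜ := by
    rw [← preimage_compl, ← himage tᶜ]
    exact (hf ht.compl).analyticSet_image hπc.measurable
  exact h1.measurableSet_of_compl h2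

/-- **Stopping at the first hitting of a closed set is Borel** on the space of unparametrised
curves: `CurveClass.stopAt F : CurveClass E → CurveClass E` is measurable for closed `F` (`E`
complete separable metric, e.g. `ℂ`). Lower semicontinuity of the hitting parameter on
parametrised curves + representative independence (`CurveClass.stopAt_mk_holds`) + Souslin
transfer. In particular the events `CurveClass.stopAt F ⁻¹' S` of `ChordalFamily.IsLocal`,
`IsTargetIndependent` and of the `markov` clause of `IsMarkovExtension` are genuine Borel events
for Borel `S`. [folklore] -/
theorem measurable_stopAt {F : Set E} (hF : IsClosed F) :
    Measurable (CurveClass.stopAt F : CurveClass E → CurveClass E) := by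
  refine measurable_of_measurable_comp_mk ?_
  have heq : (fun g : C(I, E) => CurveClass.stopAt F (CurveClass.mk (Curve.mk g))) =
      fun g => CurveClass.mk ((Curve.mk g).stopAt F) :=
    funext fun g => CurveClass.stopAt_mk_holds F hF (Curve.mk g)
  rw [heq]
  exact measurable_mk_stopAt_mk hF

/-- **Restarting from the first hitting of a closed set is Borel**:
`CurveClass.startFrom F : CurveClass E → CurveClass E` is measurable for closed `F`. [folklore] -/
theorem measurable_startFrom {F : Set E} (hF : IsClosed F) :
    Measurable (CurveClass.startFrom F : CurveClass E → CurveClass E) := by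
  refine measurable_of_measurable_comp_mk ?_
  have heq : (fun g : C(I, E) => CurveClass.startFrom F (CurveClass.mk (Curve.mk g))) =
      fun g => CurveClass.mk ((Curve.mk g).startFrom F) :=
    funext fun g => CurveClass.startFrom_mk_holds F hF (Curve.mk g)
  rw [heq]
  exact measurable_mk_startFrom_mk hF

/-- Preimages of Borel sets under stopping at a closed set are Borel. [folklore] -/
theorem measurableSet_preimage_stopAt {F : Set E} (hF : IsClosed F) {S : Set (CurveClass E)}
    (hS : MeasurableSet S) : MeasurableSet (CurveClass.stopAt F ⁻¹' S) :=
  measurable_stopAt hF hS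

/-- Preimages of Borel sets under restarting from a closed set are Borel. [folklore] -/
theorem measurableSet_preimage_startFrom {F : Set E} (hF : IsClosed F) {T : Set (CurveClass E)}
    (hT : MeasurableSet T) : MeasurableSet (CurveClass.startFrom F ⁻¹' T) :=
  measurable_startFrom hF hT

/-- The pair (initial segment, final segment) at the first hitting of a closed set is a Borel map
into the product. [folklore] -/
theorem measurable_stopAt_prodMk_startFrom {F : Set E} (hF : IsClosed F) :
    Measurable fun γ : CurveClass E => (γ.stopAt F, γ.startFrom F) :=
  (measurable_stopAt hF).prodMk (measurable_startFrom hF)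

/-- **The `markov` clause at ONE closed set is a tautology of disintegration.** For every finite
law `P` on unparametrised curves in a complete separable metric space and every closed `F` there
is a Markov kernel `κ` — the conditional law of the final segment `startFrom F` given the initial
segment `stopAt F`, i.e. `Measure.condKernel` of the joint law on the standard Borel space
`CurveClass E × CurveClass E` — with
`P {stopAt F ∈ S, startFrom F ∈ T} = ∫_{stopAt F ∈ S} κ (γ.stopAt F) T dP(γ)` for all Borel `S, T`.
So in `ChordalFamily.IsMarkovExtension` the content of `markov` is only that ONE kernel serves
ALL closed `F` simultaneously (stopping-set consistency), and that of `domain`. [folklore] -/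
theorem exists_kernel_stopAt_startFrom [Nonempty E] (P : Measure (CurveClass E))
    [IsFiniteMeasure P] {F : Set E} (hF : IsClosed F) :
    ∃ κ : Kernel (CurveClass E) (CurveClass E), IsMarkovKernel κ ∧
      ∀ S T : Set (CurveClass E), MeasurableSet S → MeasurableSet T →
        P (CurveClass.stopAt F ⁻¹' S ∩ CurveClass.startFrom F ⁻¹' T) =
          ∫⁻ γ in CurveClass.stopAt F ⁻¹' S, κ (γ.stopAt F) T ∂P := by
  haveI : Nonempty (CurveClass E) := ⟨CurveClass.mk (Curve.const (Classical.arbitrary E))⟩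
  have hs := measurable_stopAt (E := E) hF
  have ht := measurable_startFrom (E := E) hF
  have hpair := measurable_stopAt_prodMk_startFrom (E := E) hF
  set ρ : Measure (CurveClass E × CurveClass E) :=
    P.map fun γ : CurveClass E => (γ.stopAt F, γ.startFrom F) with hρ
  have hfst : ρ.fst = P.map (CurveClass.stopAt F) := by
    rw [hρ, Measure.fst_map_prodMk ht]
  refine ⟨ρ.condKernel, inferInstance, fun S T hS hT => ?_⟩
  calc P (CurveClass.stopAt F ⁻¹' S ∩ CurveClass.startFrom F ⁻¹' T)
      = ρ (S ×ˢ T) := by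
        rw [hρ, Measure.map_apply hpair (hS.prod hT)]
        rfl
    _ = (ρ.fst ⊗ₘ ρ.condKernel) (S ×ˢ T) := by rw [ρ.disintegrate ρ.condKernel]
    _ = ∫⁻ p in S, ρ.condKernel p T ∂ρ.fst := Measure.compProd_apply_prod hS hT
    _ = ∫⁻ p in S, ρ.condKernel p T ∂(P.map (CurveClass.stopAt F)) := by rw [hfst]
    _ = ∫⁻ γ in CurveClass.stopAt F ⁻¹' S, ρ.condKernel (γ.stopAt F) T ∂P :=
        setLIntegral_map hS (ρ.condKernel.measurable_coe hT) hs

end Souslin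

section EmptySet

variable {E : Type*} [MetricSpace E]

/-- Nothing to hit: the hitting parameter of `∅` is the terminal parameter `1`. [folklore] -/
theorem hitParam_empty (γ : Curve E) : γ.hitParam (∅ : Set E) = 1 :=
  Curve.hitParam_eq_one_of_forall_notMem fun _ h => h

/-- Nothing to hit: stopping at `∅` does nothing to a parametrised curve. [folklore] -/
theorem curve_stopAt_empty (γ : Curve E) : γ.stopAt (∅ : Set E) = γ := by
  refine Curve.ext (ContinuousMap.ext fun s => ?_)
  change γ.stopAt ∅ s = γ s
  rw [Curve.stopAt_apply, hitParam_empty, one_mul, projIcc_val]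

/-- Nothing to hit: the final segment from the (non-)hitting of `∅` is the constant curve at the
target. [folklore] -/
theorem curve_startFrom_empty (γ : Curve E) :
    γ.startFrom (∅ : Set E) = Curve.const γ.target := by
  refine Curve.ext (ContinuousMap.ext fun s => ?_)
  change γ.startFrom ∅ s = γ.target
  rw [Curve.startFrom_apply, hitParam_empty, sub_self, zero_mul, add_zero, projIcc_right]
  rfl

/-- `CurveClass.stopAt ∅` is the identity. [folklore] -/
theorem stopAt_empty (c : CurveClass E) : c.stopAt (∅ : Set E) = c := by
  obtain ⟨γ, rfl⟩ := CurveClass.surjective_mk c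
  rw [CurveClass.stopAt_mk_holds ∅ isClosed_empty, curve_stopAt_empty]

/-- `CurveClass.startFrom ∅` is the constant class at the target. [folklore] -/
theorem startFrom_empty (c : CurveClass E) :
    c.startFrom (∅ : Set E) = CurveClass.mk (Curve.const c.target) := by
  obtain ⟨γ, rfl⟩ := CurveClass.surjective_mk c
  rw [CurveClass.startFrom_mk_holds ∅ isClosed_empty, curve_startFrom_empty, CurveClass.target_mk]

end EmptySet

/-- **Registered sub-goal `stub_markovPassage_stopMeasurable` of `stub_markovPassage`**: for
every closed `F ⊆ ℂ`, stopping a planar curve class at / restarting it from its first hitting of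
`F` is Borel (`measurable_stopAt`, `measurable_startFrom` at `E = ℂ`). [folklore] -/
theorem stub_markovPassage_stopMeasurable : ∀ F : Set ℂ, IsClosed F → Measurable (CurveClass.stopAt F : CurveClass ℂ → CurveClass ℂ) ∧ Measurable (CurveClass.startFrom F : CurveClass ℂ → CurveClass ℂ) :=
  fun _ hF => ⟨measurable_stopAt hF, measurable_startFrom hF⟩

end Summit.CriticalPhenomena.CardyFormulaZ2.Cruxes.LagHandOff.CrosscutDictionary

end
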